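import Summits.KontsevichZagierPeriods.KontsevichZagierPeriods.Theses.HodgeColevel
import Summits.KontsevichZagierPeriods.KontsevichZagierPeriods.Theorems.HodgeColevelCoresOfSummit
import Literature.NumberTheory.Transcendental.KZCalculusProofs
import Literature.NumberTheory.Transcendental.KZLogCalculusProofs
import Literature.NumberTheory.Transcendental.KZKernelConjectureForms
import Summits.KontsevichZagierPeriods.KontsevichZagierPeriods.Theorems.DegreeEquality.Negative.ZeroLayer
import Literature.NumberTheory.Transcendental.KZVolumeConjectureProofs

/-!
# KontsevichZagierPeriods / HodgeColevel — `DegreeCompression` restricted to volumes is still the summit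
# (item stmt-KontsevichZagierPeriods-6177; support file, lands `--supports`; self-contained companion)

Companion of `HodgeColevelDegreeCompressionStrength.lean` (the crux `DegreeCompression` ⟺
`KontsevichZagierPeriods` by the *sign trick*: merge `r` and `−r'` into one representation of value
`0`). That argument uses representations with sign-changing integrands, so one might hope to repair
the route's split "Conjecture 1 = compression half ∧ same-degree half" by restricting both halves to
POSITIVE integrands, or to VOLUME representations (integrand `1` on a compact top-dimensional
domain, the setting of the volume form of Conjecture 1 [Cresson–Viu-Sos 2022, §1]). This file shows
the repair is void:

* `of_mem_relations_of_value_eq_zero`, `kzPeriodConjecture'_of_unitVolumeAccess`,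
  `unitVolumeAccess_iff_kontsevichZagierPeriods` —
  **unit-volume access is Conjecture 1**: if every compact top-dimensional `ℚ`-semialgebraic set of
  volume `1` (in any dimension, as the representation `∫_K 1`) can be moved to a point by the KZ
  rules, then any two integral representations with equal values are KZ-equivalent. Proof (the
  *complement/gluing trick*, all ingredients in tree): Conjecture 1 ⟸ every representation `R` of
  value `0` is a relation (merge `r` and `−r'` into one `R`, as in the companion file; redone here so
  that this file does not depend on it); glue the point `C = [ℝ⁰, 1]` to `R`
  (`KZ.IntegralRep.exists_of_add_of_sub_of_mem_relations`), pass to KZ's literal shape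
  (`KZ.exists_isRational_equivalent_holds`) and apply Viu-Sos' semi-canonical reduction
  (`KZ.semiCanonicalReduction_holds`, [Viu-Sos 2021, Thm. 1.1], discharged in tree): `[R] + [C] ≡ [K]`
  with `K` a compact volume representation, of volume `1` by soundness; unit-volume access moves `K`
  to a point `s` of value `1`, which IS `C` (`eq_of_dim_zero_of_value_eq`); so `[R] ≡ 0`.
* `kontsevichZagierPeriods_of_volumeCompression`, `volumeCompression_iff_kontsevichZagierPeriods` —
  `DegreeCompression` restricted to pairs of VOLUME representations (hence to positive, bounded,
  KZ-rational integrands on compact top-dimensional domains) is still equivalent to the summit: at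
  `k = 0` against the point `C` it is unit-volume access.

So no restriction of the compression half by sign, boundedness, compactness or rationality of the
data separates it from Conjecture 1 (strategist r1 of crux stmt-KontsevichZagierPeriods-6177, census
§ Strengthen / § Decomposition). No definitions are introduced.

Sources: M. Kontsevich, D. Zagier, *Periods* (2001), §1.2 (rules (1)–(3), Conjecture 1, "accessible
identities"); J. Viu-Sos, *A semi-canonical reduction for periods of Kontsevich–Zagier*, IJNT 17
(2021), Thm. 1.1; J. Cresson, J. Viu-Sos, JTNB 34 (2022), §1 (volume form of Conjecture 1).
-/

noncomputable section

open MeasureTheory Set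
open Literature.NumberTheory.Transcendental
open Summit.KontsevichZagierPeriods.KontsevichZagierPeriods.Theses.HodgeColevel (DegreeCompression)
open Summit.KontsevichZagierPeriods.Theorems.DegreeEquality.Negative
  (eq_of_dim_zero_of_value_eq value_eq_of_dim_zero)

namespace Summit.KontsevichZagierPeriods.HodgeColevel.UnitVolumeAccessStrength

variable {n m : ℕ}

/-- A `0`-dimensional volume representation (non-empty domain, integrand `1`) has value `1`.
[Kontsevich–Zagier 2001, §1.1] [folklore] -/
theorem value_eq_one_of_dimZero (C : KZ.IntegralRep 0) (hCi : (interior C.domain).Nonempty)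
    (hC1 : ∀ x ∈ C.domain, C.integrand x = 1) : C.value = 1 := by
  obtain ⟨x, hx⟩ := hCi
  have hx' : x ∈ C.domain := interior_subset hx
  rw [value_eq_of_dim_zero C ⟨x, hx'⟩, Subsingleton.elim default x, hC1 x hx']

/-- A representation with integrand `1` on its domain has KZ's literal rational shape (`1 / 1`).
[Kontsevich–Zagier 2001, §1.1] [folklore] -/
theorem isRational_of_integrand_eq_one (K : KZ.IntegralRep n) (h1 : ∀ x ∈ K.domain, K.integrand x = 1) :
    K.IsRational :=
  ⟨1, 1, fun _ _ => by simp, fun x hx => by simp [h1 x hx]⟩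

/-- **Under unit-volume access every representation of value `0` is a relation.** Glue the point
`C = [ℝ⁰, 1]` to `R` (`[R] + [C] ≡ [R₀]`), pass to KZ's literal shape (`R₀ ~ R'`,
`KZ.exists_isRational_equivalent_holds`), reduce `R'` (value `1 ≠ 0`) to a compact volume `K` by
Viu-Sos' semi-canonical reduction (`KZ.semiCanonicalReduction_holds`); `vol K = 1` by soundness, so
unit-volume access moves `K` to a point `s` of value `1`, and `s = C` (`eq_of_dim_zero_of_value_eq`);
the telescoping sum `[R] = ([R]+[C]−[R₀]) + ([R₀]−[R']) + ([R']−[K]) + ([K]−[C])` is a relation.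
[Viu-Sos 2021, Thm. 1.1; Cresson–Viu-Sos 2022, §1] [cite: ViuSos2021, Thm. 1.1] -/
theorem of_mem_relations_of_value_eq_zero
    (h : ∀ (d : ℕ) (K : KZ.IntegralRep d), IsCompact K.domain → (interior K.domain).Nonempty →
      (∀ x ∈ K.domain, K.integrand x = 1) → K.value = 1 →
        ∃ s : KZ.IntegralRep 0, KZ.Equivalent K s)
    {N : ℕ} (R : KZ.IntegralRep N) (hR0 : R.value = 0) : KZ.of R ∈ KZ.relations := by
  obtain ⟨C, hCc, hCi, hC1⟩ := KZ.IntegralRep.exists_volumeRep_zero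
  have hCv : C.value = 1 := value_eq_one_of_dimZero C hCi hC1
  -- glue the point to `R`, pass to KZ's literal shape, reduce to a compact volume
  obtain ⟨N₀, R₀, hR₀⟩ := R.exists_of_add_of_sub_of_mem_relations C
  obtain ⟨m, R', hR', hR₀R'⟩ := KZ.exists_isRational_equivalent_holds R₀
  have hR'v : R'.value = 1 := by
    have h0 := KZ.relations_le_ker_eval_holds hR₀
    rw [AddMonoidHom.mem_ker, map_sub, map_add, KZ.eval_of, KZ.eval_of, KZ.eval_of, hR0,
      hCv] at h0
    rw [← KZ.Equivalent.value_eq_holds hR₀R']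
    linarith
  obtain ⟨k, K, -, -, hKc, hKi, hK1, hKpos, -⟩ :=
    KZ.semiCanonicalReduction_holds R' hR' (by rw [hR'v]; exact one_ne_zero)
  have hR'K : KZ.Equivalent R' K := hKpos (by rw [hR'v]; exact one_pos)
  have hKv : K.value = 1 := by rw [← KZ.Equivalent.value_eq_holds hR'K, hR'v]
  -- unit-volume access: `K` moves to a point, which is `C`
  obtain ⟨s, hs⟩ := h k K hKc hKi hK1 hKv
  have hsv : s.value = 1 := by rw [← KZ.Equivalent.value_eq_holds hs, hKv]
  have hsC : s = C :=
    eq_of_dim_zero_of_value_eq (by rw [hsv, hCv]) (by rw [hCv]; exact one_ne_zero)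
  have hKC : KZ.of K - KZ.of C ∈ KZ.relations := hsC ▸ hs
  have : KZ.of R = (KZ.of R + KZ.of C - KZ.of R₀) + (KZ.of R₀ - KZ.of R') +
      (KZ.of R' - KZ.of K) + (KZ.of K - KZ.of C) := by abel
  rw [this]
  exact KZ.relations.add_mem (KZ.relations.add_mem (KZ.relations.add_mem hR₀ hR₀R') hR'K) hKC

/-- **Unit-volume access ⇒ Conjecture 1** (semialgebraic two-representation form). If every volume
representation `∫_K 1` (`K` compact, top-dimensional, `ℚ`-semialgebraic, any dimension) of volume `1`
is KZ-equivalent to a `0`-dimensional representation, then `KZPeriodConjecture'` holds: merge `r` and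
`−r'` (equal values) into ONE representation `R` by slabs
(`KZ.IntegralRep.exists_of_add_of_sub_of_mem_relations`), of value `0` by soundness; `[R]` is a
relation by `of_mem_relations_of_value_eq_zero`, and
`[r] − [r'] = ([r] + [−r'] − [R]) + [R] − ([r'] + [−r'])` (`KZ.of_add_of_mem_relations_of_eqOn_neg`).
[Kontsevich–Zagier 2001, §1.2 Conjecture 1; Viu-Sos 2021, Thm. 1.1] [cite: ViuSos2021, Thm. 1.1] -/
theorem kzPeriodConjecture'_of_unitVolumeAccess
    (h : ∀ (d : ℕ) (K : KZ.IntegralRep d), IsCompact K.domain → (interior K.domain).Nonempty →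
      (∀ x ∈ K.domain, K.integrand x = 1) → K.value = 1 →
        ∃ s : KZ.IntegralRep 0, KZ.Equivalent K s) :
    KZPeriodConjecture' := by
  intro n m r r' hv
  obtain ⟨N, R, hR⟩ := KZ.IntegralRep.exists_of_add_of_sub_of_mem_relations r r'.neg
  have hneg : KZ.of r' + KZ.of r'.neg ∈ KZ.relations :=
    KZ.of_add_of_mem_relations_of_eqOn_neg (r := r') (r' := r'.neg) rfl fun _ _ => rfl
  have hR0 : R.value = 0 := by
    have hk := KZ.relations_le_ker_eval_holds hR
    rw [AddMonoidHom.mem_ker, map_sub, map_add, KZ.eval_of, KZ.eval_of, KZ.eval_of,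
      KZ.IntegralRep.value_neg, hv] at hk
    linarith
  have hrel : KZ.of R ∈ KZ.relations := of_mem_relations_of_value_eq_zero h R hR0
  have : KZ.of r - KZ.of r' =
      (KZ.of r + KZ.of r'.neg - KZ.of R) + KZ.of R - (KZ.of r' + KZ.of r'.neg) := by abel
  rw [show KZ.Equivalent r r' ↔ KZ.of r - KZ.of r' ∈ KZ.relations from Iff.rfl, this]
  exact KZ.relations.sub_mem (KZ.relations.add_mem hR hrel) hneg

/-- **Unit-volume access ⟺ the summit.** "Every compact top-dimensional `ℚ`-semialgebraic set of
volume `1` can be moved to a point (equivalently, to the unit cube) by the rules" is equivalent to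
the Kontsevich–Zagier period conjecture; the converse direction compares `K` with the point
`[ℝ⁰, 1]` under Conjecture 1. [Viu-Sos 2021, Thm. 1.1; Kontsevich–Zagier 2001, §1.2 Conjecture 1] [folklore] -/
theorem unitVolumeAccess_iff_kontsevichZagierPeriods :
    (∀ (d : ℕ) (K : KZ.IntegralRep d), IsCompact K.domain → (interior K.domain).Nonempty →
      (∀ x ∈ K.domain, K.integrand x = 1) → K.value = 1 →
        ∃ s : KZ.IntegralRep 0, KZ.Equivalent K s) ↔
      KontsevichZagierPeriods := by
  refine ⟨fun h => kzPeriodConjecture'_iff_isRational.mp (kzPeriodConjecture'_of_unitVolumeAccess h),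
    fun H d K _ hKi hK1 hKv => ?_⟩
  obtain ⟨C, -, hCi, hC1⟩ := KZ.IntegralRep.exists_volumeRep_zero
  have H' : KZPeriodConjecture' := kzPeriodConjecture'_iff_isRational.mpr H
  exact ⟨C, H' K C (by rw [hKv, value_eq_one_of_dimZero C hCi hC1])⟩

/-- **`DegreeCompression` restricted to volume representations ⇒ the summit.** Even for pairs
`r`, `r'` of VOLUME representations (integrand `1` — positive, bounded, KZ-rational — on compact
top-dimensional domains), "equal values ⇒ the same dimensions are reachable" implies Conjecture 1:
at `k = 0`, with `r` the point `[ℝ⁰, 1]`, it is unit-volume access.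
[Kontsevich–Zagier 2001, §1.2 Conjecture 1; Viu-Sos 2021, Thm. 1.1] [folklore] -/
theorem kontsevichZagierPeriods_of_volumeCompression
    (hV : ∀ ⦃n m : ℕ⦄ (r : KZ.IntegralRep n) (r' : KZ.IntegralRep m),
      IsCompact r.domain → (interior r.domain).Nonempty → (∀ x ∈ r.domain, r.integrand x = 1) →
      IsCompact r'.domain → (interior r'.domain).Nonempty → (∀ x ∈ r'.domain, r'.integrand x = 1) →
      r.value = r'.value → ∀ (k : ℕ), (∃ s : KZ.IntegralRep k, KZ.Equivalent r s) →
        ∃ s' : KZ.IntegralRep k, KZ.Equivalent r' s') :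
    KontsevichZagierPeriods := by
  refine unitVolumeAccess_iff_kontsevichZagierPeriods.mp fun d K hKc hKi hK1 hKv => ?_
  obtain ⟨C, hCc, hCi, hC1⟩ := KZ.IntegralRep.exists_volumeRep_zero
  have hCv : C.value = 1 := value_eq_one_of_dimZero C hCi hC1
  exact hV C K hCc hCi hC1 hKc hKi hK1 (by rw [hCv, hKv]) 0 ⟨C, KZ.Equivalent.refl C⟩

/-- **Volume-restricted `DegreeCompression` ⟺ the summit** (converse through the landed
`coresOfSummit_proof`, item 6183: volume representations are KZ-rational). Restricting
the route's first core by sign / boundedness / compactness of the data does not make it weaker than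
Conjecture 1. [Kontsevich–Zagier 2001, §1.2 Conjecture 1] [folklore] -/
theorem volumeCompression_iff_kontsevichZagierPeriods :
    (∀ ⦃n m : ℕ⦄ (r : KZ.IntegralRep n) (r' : KZ.IntegralRep m),
      IsCompact r.domain → (interior r.domain).Nonempty → (∀ x ∈ r.domain, r.integrand x = 1) →
      IsCompact r'.domain → (interior r'.domain).Nonempty → (∀ x ∈ r'.domain, r'.integrand x = 1) →
      r.value = r'.value → ∀ (k : ℕ), (∃ s : KZ.IntegralRep k, KZ.Equivalent r s) →
        ∃ s' : KZ.IntegralRep k, KZ.Equivalent r' s') ↔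
      KontsevichZagierPeriods :=
  ⟨kontsevichZagierPeriods_of_volumeCompression, fun H _ _ r r' _ _ h1 _ _ h1' hv k hk =>
    (Summit.KontsevichZagierPeriods.HodgeColevel.coresOfSummit_proof H).1 r r'
      (isRational_of_integrand_eq_one r h1) (isRational_of_integrand_eq_one r' h1') hv k hk⟩

end Summit.KontsevichZagierPeriods.HodgeColevel.UnitVolumeAccessStrength

end
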